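import Literature.AnabelianGeometry.SemiGraphs.TemperedAnchoredCompactOfLocallyFinite
import Literature.AnabelianGeometry.SemiGraphs.TemperedEdgeLikeIsInfVerticialHolds
import HarnessLib

/-!
# [SemiAnbd] Thm 3.7 (iv) at locally finite `𝒢`: verticial ⇒ maximal compact, and (iv) for ANCHORED subgroups

Mochizuki, *Semi-graphs of anabelioids*, Publ. RIMS **42** (2006), §3, Theorem 3.7 (iv) p. 41
[cite: MochizukiSemiAnbd2006, Thm 3.7(iv) p.41]: "the maximal compact subgroups of `π₁^temp(𝒢)` are precisely
the verticial subgroups of `π₁^temp(𝒢)`; the nontrivial intersections of two distinct maximal compact subgroups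
are precisely the edge-like subgroups [of closed edges]".

PROOF-ONLY (cell abc-iut, layer L3, GAP row G-t6g3-2; seat abc-iut-w6-d062, HBDD-LOCFIN follow-through; no
definition).  In print (iv) follows from (iii); the cell's per-graph reduction is abc-iut-L3-t6/t11's
`maximalCompactIffVerticialAt_of_compactInVerticialAt`, and `CompactInVerticialAt` FAILS at abc-iut-L3-d1's
locally finite countermodel `𝒢_θ`.  At every countable LOCALLY FINITE `𝒢` satisfying the hypotheses of Thm 3.7,
and in every chart, the following parts of (iv) nevertheless HOLD (inputs: this seat's anchored existence
theorem `exists_verticial_ge_of_inf_verticial_ne_bot_of_isLocallyFinite`, its `compactInTwoVerticial_of_isLocallyFinite`,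
Thm 3.7 (ii) `verticialDistinct_holds` via abc-iut-L3-t6's `eq_of_le_of_mem_verticialSubgroups`, and abc-iut-f-173's
`edgeLikeIsInfVerticialAt_holds`):

* `isMaximalCompactSubgroup_of_mem_verticialSubgroups_of_isLocallyFinite` — EVERY verticial subgroup is a
  maximal compact subgroup (a compact over-group is anchored at it; a trivial verticial subgroup forces
  `π₁^temp(𝒢) = 1` by (ii));
* `isMaximalCompactSubgroup_iff_mem_verticialSubgroups_of_anchored_of_isLocallyFinite` — for ANCHORED `K`
  (`K ⊓ H₀ ≠ 1` for some verticial `H₀`): maximal compact ⇔ verticial;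
* `exists_maximalCompact_inf_eq_of_mem_edgeLikeSubgroups_of_isLocallyFinite` — every nontrivial edge-like
  subgroup of a closed edge IS the intersection of two distinct maximal compact subgroups (unconditional);
* `exists_mem_edgeLikeSubgroups_of_maximalCompact_inf_of_anchored_of_isLocallyFinite` — conversely for an
  intersection `K₁ ⊓ K₂ ≠ 1` of two distinct maximal compact subgroups ONE OF WHICH IS ANCHORED.

So at locally finite `𝔾` the whole of Thm 3.7 (iii)–(iv) holds away from ANCHOR-FREE compact subgroups; nothing
here asserts it for those; nothing bears on [IUTchIII] Cor. 3.12; typed ≠ proved.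
-/

namespace Literature.AnabelianGeometry.SemiGraphs

namespace ProfiniteSemiGraph

open Topology

universe u

variable (𝒢 : ProfiniteSemiGraph.{u})

/-- **Thm 3.7 (iv), «verticial ⇒ maximal compact», at every locally finite countable `𝒢` and every chart**:
a verticial subgroup `H` is compact, and a compact `K ⊇ H` equals `H` — if `H ≠ 1`, `K` is anchored at `H`,
so lies in a verticial `H'` ⊇ `H`, and `H = H'` by Thm 3.7 (ii) (`eq_of_le_of_mem_verticialSubgroups`); if
`H = 1`, Thm 3.7 (ii) (second clause of `VerticialDistinct`) forces `π₁^temp(𝒢) = 1`.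
[cite: MochizukiSemiAnbd2006, Thm 3.7(iv) p.41] -/
theorem isMaximalCompactSubgroup_of_mem_verticialSubgroups_of_isLocallyFinite (h37 : 𝒢.Thm37Hypotheses)
    (hlf : 𝒢.graph.IsLocallyFinite) (c : TemperedPiChart 𝒢) {v : 𝒢.graph.Vertex} {H : Subgroup c.G}
    (hH : H ∈ verticialSubgroups c v) : IsMaximalCompactSubgroup H := by
  refine ⟨isCompact_of_mem_verticialSubgroups c hH, fun K hKc hHK => ?_⟩
  by_cases hbot : H = ⊥
  · -- `π₁^temp(𝒢)` is trivial
    refine le_antisymm (fun g hg => ?_) hHK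
    by_contra hgH
    obtain ⟨-, h2⟩ := verticialDistinct_holds 𝒢 h37 c
    have h0 := h2 v H hH 1 g (by simpa using hgH)
    subst hbot
    simp at h0
  · obtain ⟨v', H', hH', hKH'⟩ := 𝒢.exists_verticial_ge_of_inf_verticial_ne_bot_of_isLocallyFinite h37 hlf
      c K hKc hH (by rwa [inf_eq_right.mpr hHK])
    have hHH' : H = H' :=
      eq_of_le_of_mem_verticialSubgroups verticialDistinct_holds h37 c hH hH' (hHK.trans hKH')
    subst hHH'
    exact le_antisymm hKH' hHK

/-- **Thm 3.7 (iv), first sentence, for ANCHORED subgroups** (`𝒢` locally finite, every chart): a subgroup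
`K` meeting some verticial subgroup nontrivially is maximal compact iff it is verticial.
[cite: MochizukiSemiAnbd2006, Thm 3.7(iv) p.41] -/
theorem isMaximalCompactSubgroup_iff_mem_verticialSubgroups_of_anchored_of_isLocallyFinite
    (h37 : 𝒢.Thm37Hypotheses) (hlf : 𝒢.graph.IsLocallyFinite) (c : TemperedPiChart 𝒢) (K : Subgroup c.G)
    {v₀ : 𝒢.graph.Vertex} {H₀ : Subgroup c.G} (hH₀ : H₀ ∈ verticialSubgroups c v₀) (hanch : K ⊓ H₀ ≠ ⊥) :
    IsMaximalCompactSubgroup K ↔ ∃ v : 𝒢.graph.Vertex, K ∈ verticialSubgroups c v :=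
  ⟨fun hK => 𝒢.exists_mem_verticialSubgroups_of_isMaximalCompactSubgroup_of_isLocallyFinite h37 hlf c K
      hK hH₀ hanch,
    fun ⟨_, hK⟩ => 𝒢.isMaximalCompactSubgroup_of_mem_verticialSubgroups_of_isLocallyFinite h37 hlf c hK⟩

/-- **Thm 3.7 (iv), second sentence «⇐», at every locally finite countable `𝒢` and every chart**
(unconditional): a nontrivial edge-like subgroup of a CLOSED edge is the intersection of two DISTINCT
maximal compact subgroups (abc-iut-f-173's `edgeLikeIsInfVerticialAt_holds`: it is `H₁ ⊓ H₂` for distinct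
verticial `H₁`, `H₂`, which are maximal compact by the previous theorem). [cite: MochizukiSemiAnbd2006, Thm 3.7(iv) p.41] -/
theorem exists_maximalCompact_inf_eq_of_mem_edgeLikeSubgroups_of_isLocallyFinite (h37 : 𝒢.Thm37Hypotheses)
    (hlf : 𝒢.graph.IsLocallyFinite) (c : TemperedPiChart 𝒢) {e : 𝒢.graph.Edge} (he : 𝒢.graph.IsClosedEdge e)
    {L : Subgroup c.G} (hL : L ∈ edgeLikeSubgroups c e) (hLne : L ≠ ⊥) :
    ∃ K₁ K₂ : Subgroup c.G, IsMaximalCompactSubgroup K₁ ∧ IsMaximalCompactSubgroup K₂ ∧ K₁ ≠ K₂ ∧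
      L = K₁ ⊓ K₂ := by
  obtain ⟨v₁, v₂, H₁, H₂, hH₁, hH₂, hne, rfl⟩ := edgeLikeIsInfVerticialAt_holds 𝒢 h37 c e he L hL hLne
  exact ⟨H₁, H₂, 𝒢.isMaximalCompactSubgroup_of_mem_verticialSubgroups_of_isLocallyFinite h37 hlf c hH₁,
    𝒢.isMaximalCompactSubgroup_of_mem_verticialSubgroups_of_isLocallyFinite h37 hlf c hH₂, hne, rfl⟩

/-- **Thm 3.7 (iv), second sentence «⇒», for an ANCHORED pair** (`𝒢` locally finite, every chart): a
nontrivial intersection `K₁ ⊓ K₂` of two distinct maximal compact subgroups, one of which meets some verticial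
subgroup nontrivially, is an edge-like subgroup of a closed edge.  (`K₁` is verticial; `K₂` is anchored at
`K₁`, hence verticial; `K₁ ⊓ K₂` is compact and lies in two distinct verticial subgroups, so — sentences 2–3
of (iii), `compactInTwoVerticial_of_isLocallyFinite` — in an edge-like `L'` of a closed edge, and
`L' = H₁ ⊓ H₂` (f-173) with `{H₁, H₂} = {K₁, K₂}`.) [cite: MochizukiSemiAnbd2006, Thm 3.7(iv) p.41] -/
theorem exists_mem_edgeLikeSubgroups_of_maximalCompact_inf_of_anchored_of_isLocallyFinite
    (h37 : 𝒢.Thm37Hypotheses) (hlf : 𝒢.graph.IsLocallyFinite) (c : TemperedPiChart 𝒢)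
    {K₁ K₂ : Subgroup c.G} (hK₁ : IsMaximalCompactSubgroup K₁) (hK₂ : IsMaximalCompactSubgroup K₂)
    (hne : K₁ ≠ K₂) (hL : K₁ ⊓ K₂ ≠ ⊥)
    {v₀ : 𝒢.graph.Vertex} {H₀ : Subgroup c.G} (hH₀ : H₀ ∈ verticialSubgroups c v₀) (hanch : K₁ ⊓ H₀ ≠ ⊥) :
    ∃ e : 𝒢.graph.Edge, 𝒢.graph.IsClosedEdge e ∧ K₁ ⊓ K₂ ∈ edgeLikeSubgroups c e := by
  obtain ⟨v₁, hK₁v⟩ :=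
    𝒢.exists_mem_verticialSubgroups_of_isMaximalCompactSubgroup_of_isLocallyFinite h37 hlf c K₁ hK₁ hH₀ hanch
  obtain ⟨v₂, hK₂v⟩ :=
    𝒢.exists_mem_verticialSubgroups_of_isMaximalCompactSubgroup_of_isLocallyFinite h37 hlf c K₂ hK₂ hK₁v
      (by rwa [inf_comm])
  haveI := c.t2Space
  have hLc : IsCompact ((K₁ ⊓ K₂ : Subgroup c.G) : Set c.G) := by
    rw [Subgroup.coe_inf]
    exact hK₁.1.inter_right hK₂.1.isClosed
  obtain ⟨honly, e, L', he, hL', hLL'⟩ := 𝒢.compactInTwoVerticial_of_isLocallyFinite h37 hlf c (K₁ ⊓ K₂)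
    hLc hL hK₁v hK₂v hne inf_le_left inf_le_right
  have hL'ne : L' ≠ ⊥ := fun h => hL (le_bot_iff.mp (h ▸ hLL'))
  obtain ⟨w₁, w₂, H₁, H₂, hH₁, hH₂, hH, rfl⟩ := edgeLikeIsInfVerticialAt_holds 𝒢 h37 c e he L' hL' hL'ne
  have hH₁' := honly w₁ H₁ hH₁ (hLL'.trans inf_le_left)
  have hH₂' := honly w₂ H₂ hH₂ (hLL'.trans inf_le_right)
  refine ⟨e, he, ?_⟩
  rcases hH₁' with rfl | rfl <;> rcases hH₂' with rfl | rfl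
  · exact absurd rfl hH
  · exact hL'
  · rw [inf_comm]; exact hL'
  · exact absurd rfl hH

end ProfiniteSemiGraph

end Literature.AnabelianGeometry.SemiGraphs
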